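import Literature.Probability.LatticeModels.DartPhase
import Literature.Probability.LatticeModels.DirichletGreenFunction
import Literature.Probability.RandomPlanarGeometry.PlanarDomains
import Summits.CriticalPhenomena.CardyFormulaZ2.Theorems.CardySusyWardParafermionPrecompactKenyonDefs
import Summits.CriticalPhenomena.CardyFormulaZ2.Theorems.CardySusyWardParafermionPrecompactInnerCycleSteps
import Summits.CriticalPhenomena.CardyFormulaZ2.Theorems.CardySusyWardParafermionPrecompactFourDartSplit
import Literature.Probability.LatticeModels.MedialWindingBridge
import Literature.Probability.LatticeModels.SHolomorphicityProof

/-!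
# The vertex relation: lattice and geometric bookkeeping (helper for stub `stub_vertexRelation`)

Line `kenyon-stream-second-relation` of the crux `ParafermionPrecompact` (route `CardySusyWard`,
item stmt-CriticalPhenomena-11293). The non-probabilistic glue between the registered stub
`stub_vertexRelation` (vertex residual `vRes` of the dart field at a genuine medial vertex
`mv (y, i)`, `2δ`-ball hypothesis) and the combinatorial pair identity of `…PairIdentity.lean`
(dart sums `dsum` of cut orbits at coded corners):

* `dartPhaseSum_explorationList`: the spin-`1/3` dart phase sum of the cut orbit at a coded corner
  IS its dart sum (`winding_orbitPts`: the polyline winding up to the `k`-th dart is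
  `(π/2)·turnCount k`, so the phase is `𝓊^{-C_k}`, `𝓊 = e^{iπ/6}`);
* `cornersAt_zero_eq`, `cornersAt_one_eq`, `mv_eq_cTgt`: the four corners `NW, NE, SE, SW` of the
  vocabulary file as the coded corners `P, partner P, P⁺, (partner P)⁺` around the in-dart `P` of
  the edge (`NE` for a horizontal edge, `NW` for a vertical one), and `mv (y, i) = cTgt P`;
* `faces_inner_of_ball`: a `2δ`-deep edge whose vertex lies in `Ω_δ` has all faces at both
  endpoints inner (the closed faces lie in the ball, `smul_closedSq_subset_closedBall`, and a face
  with a corner in `Ω_δ` whose closed square lies in `Ω` is inner, `exists_mem_closedSq_not_mem`);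
  hence (`toggle_hypotheses_symmDiff`) the completions of `ω` and `ω ∆ {e}` agree off `e`, differ
  at `e`, and `e` touches no arc;
* `dartPhaseSum_eq_zero_of_not_isInnerFace` (registered helper): the exploration only carries
  corners with inner faces, for every datum and configuration.

References: H. Duminil-Copin, J. Phys. A 45 (2012) 494013, Def. 3 [DuminilCopin2012Parafermion];
H. Duminil-Copin, S. Smirnov, Clay Math. Proc. 15 (2012), §8.3 [DuminilCopinSmirnov2012Lattice];
S. Smirnov, C. R. Acad. Sci. 333 (2001), §2 [Smirnov2001].
-/

noncomputable section

namespace Summit.CriticalPhenomena.CardyFormulaZ2.Cruxes.ParafermionPrecompact.KenyonStreamSecondRelation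

open Finset
open _root_.Literature.Topology.PlaneTopology _root_.Literature.Topology.PlaneTopology.RectLoop
open _root_.Literature.Probability.LatticeModels
open _root_.Literature.Probability.Percolation (BondConfig bondPercolation half)
open _root_.Literature.Probability.RandomPlanarGeometry (DobrushinDomain)

/-! ## Assembly: from the pointwise pair identity to the vertex relation -/

section Assembly

open Complex MeasureTheory Metric
open _root_.Literature.Probability (Percolation.coordVec Percolation.coordVec_zero Percolation.coordVec_one)
open scoped Pointwise

local notation "𝓊" => Complex.exp (((Real.pi / 6 : ℝ) : ℂ) * Complex.I)

local notation "dsum[" β₀ ", " c ", " N ", " r "]" =>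
  ∑ j ∈ Finset.filter (fun j => cornerOrbit β₀ c j = r) (Finset.range N), 𝓊 ^ (-(turnCount β₀ c j))

variable {E : DiscreteDobrushin}

/-! ### Bridge: the dart phase sums of the cut orbit are the dart sums -/

/-- **The spin-`1/3` dart phase sum of the cut orbit at a coded corner is its dart sum**: the
darts carried by the corner `r` sit at the positions `k < N` with `orb k = r`, and the polyline
winding up to such a dart is `(π/2)·turnCount k` (`winding_orbitPts`), so the phase is
`e^{-(i/3)(π/2) C_k} = 𝓊^{-C_k}`. [cite: DuminilCopin2012Parafermion, Definition 3] -/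
theorem dartPhaseSum_explorationList {δ : ℝ} (hδ : δ ≠ 0) (β₀ : BondConfig (Site 2)) (c : Site 2 × Fin 4)
    (N : ℕ) (r : Site 2 × Fin 4) :
    Parafermion.dartPhaseSum (explorationList β₀ c N) δ (1 / 3) (r.1, cFace r) = dsum[β₀, c, N, r] := by
  unfold Parafermion.dartPhaseSum
  have hlen := length_explorationList' (β := β₀) (c₀ := c) N
  have hfilt : (Finset.range (explorationList β₀ c N).length).filter
      (fun k => (explorationList β₀ c N)[k]? = some (cornerSource (r.1, cFace r).1 (r.1, cFace r).2) ∧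
        (explorationList β₀ c N)[k + 1]? = some (cornerTarget (r.1, cFace r).1 (r.1, cFace r).2)) =
      (Finset.range N).filter (fun k => cornerOrbit β₀ c k = r) := by
    ext k
    simp only [Finset.mem_filter, Finset.mem_range, hlen]
    rw [cornerSource_cFace, cornerTarget_cFace]
    constructor
    · rintro ⟨hk, h1, h2⟩
      have hk1 : k + 1 < N + 1 := by
        by_contra h
        rw [List.getElem?_eq_none (by rw [hlen]; omega)] at h2
        simp at h2
      rw [List.getElem?_eq_getElem (by rw [hlen]; omega), getElem_explorationList', Option.some.injEq] at h1
      rw [List.getElem?_eq_getElem (by rw [hlen]; exact hk1), getElem_explorationList', Option.some.injEq] at h2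
      change cSrc (nextCorner β₀ (cornerOrbit β₀ c k)) = cTgt r at h2
      rw [cSrc_nextCorner] at h2
      exact ⟨by omega, eq_of_cSrc_eq_of_cTgt_eq h1 h2⟩
    · rintro ⟨hk, rfl⟩
      refine ⟨by omega, ?_, ?_⟩
      · rw [List.getElem?_eq_getElem (by rw [hlen]; omega), getElem_explorationList']
      · rw [List.getElem?_eq_getElem (by rw [hlen]; omega), getElem_explorationList']
        change some (cSrc (nextCorner β₀ (cornerOrbit β₀ c k))) = _
        rw [cSrc_nextCorner]
  rw [hfilt]
  refine Finset.sum_congr rfl fun k hk => ?_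
  rw [Finset.mem_filter, Finset.mem_range] at hk
  rw [Polyline.winding_eq_winding, map_medialPoint_explorationList, show k + 2 = (k + 1) + 1 from rfl,
    take_orbitPts δ c (Nat.succ_le_of_lt hk.1), winding_orbitPts hδ, Nat.succ_sub_one, sum_turnOf_eq]
  have hC : (∑ i ∈ Finset.range k, (turnSign β₀ (cornerOrbit β₀ c i) : ℝ)) = (turnCount β₀ c k : ℝ) := by
    rw [turnCount]; push_cast; rfl
  rw [hC, show -I * (((1 / 3 : ℝ)) : ℂ) * ((Real.pi / 2 * (turnCount β₀ c k : ℝ) : ℝ) : ℂ) =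
    ((-turnCount β₀ c k : ℤ) : ℂ) * (((Real.pi / 6 : ℝ) : ℂ) * I) by push_cast; ring, Complex.exp_int_mul]

/-- `dartPhaseSum_explorationList` for a corner written as a pair. [cite: DuminilCopin2012Parafermion, Definition 3] -/
theorem dartPhaseSum_explorationList' {δ : ℝ} (hδ : δ ≠ 0) (β₀ : BondConfig (Site 2)) (c : Site 2 × Fin 4)
    (N : ℕ) (v : Site 2) (k : Fin 4) :
    Parafermion.dartPhaseSum (explorationList β₀ c N) δ (1 / 3) (v, cFace (v, k)) = dsum[β₀, c, N, (v, k)] :=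
  dartPhaseSum_explorationList hδ β₀ c N (v, k)

/-! ### The vertex residual in coded corners -/

/-- The four corners at the horizontal edge `s(y, y + e₀)` as coded corners around the in-dart
`P = (y + e₀, 1)` (position `NE`): `NE = P`, `SW = partner P`, `SE = P⁺`, `NW = (partner P)⁺`
(`q⁺ = (q.1, q.2 + 1)` the corner leaving the edge around the vertex of `q`). [folklore] -/
theorem cornersAt_zero_eq (y : Site 2) :
    cornersAt y 0 1 = ((y + cornerUnit 0, (1 : Fin 4)).1, cFace (y + cornerUnit 0, (1 : Fin 4))) ∧
    cornersAt y 0 3 = ((cornerPartner (y + cornerUnit 0, (1 : Fin 4))).1,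
      cFace (cornerPartner (y + cornerUnit 0, (1 : Fin 4)))) ∧
    cornersAt y 0 2 = (((y + cornerUnit 0, (1 : Fin 4)).1, (y + cornerUnit 0, (1 : Fin 4)).2 + 1).1,
      cFace ((y + cornerUnit 0, (1 : Fin 4)).1, (y + cornerUnit 0, (1 : Fin 4)).2 + 1)) ∧
    cornersAt y 0 0 = (((cornerPartner (y + cornerUnit 0, (1 : Fin 4))).1,
        (cornerPartner (y + cornerUnit 0, (1 : Fin 4))).2 + 1).1,
      cFace ((cornerPartner (y + cornerUnit 0, (1 : Fin 4))).1,
        (cornerPartner (y + cornerUnit 0, (1 : Fin 4))).2 + 1)) := by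
  refine ⟨Prod.ext ?_ ?_, Prod.ext ?_ ?_, Prod.ext ?_ ?_, Prod.ext ?_ ?_⟩ <;>
    refine Site.ext_two ?_ ?_ <;>
    simp [cornersAt, ex, cFace, faceAt, cornerOff, cornerPartner, cornerUnit, show (1 : Fin 4) + 1 = 2 from rfl,
      show (1 : Fin 4) + 2 = 3 from rfl, show (3 : Fin 4) + 1 = 0 from rfl]

/-- The same at the vertical edge `s(y, y + e₁)` around the in-dart `P = (y + e₁, 2)` (position
`NW`): `NW = P`, `SE = partner P`, `NE = P⁺`, `SW = (partner P)⁺`. [folklore] -/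
theorem cornersAt_one_eq (y : Site 2) :
    cornersAt y 1 0 = ((y + cornerUnit 1, (2 : Fin 4)).1, cFace (y + cornerUnit 1, (2 : Fin 4))) ∧
    cornersAt y 1 2 = ((cornerPartner (y + cornerUnit 1, (2 : Fin 4))).1,
      cFace (cornerPartner (y + cornerUnit 1, (2 : Fin 4)))) ∧
    cornersAt y 1 1 = (((y + cornerUnit 1, (2 : Fin 4)).1, (y + cornerUnit 1, (2 : Fin 4)).2 + 1).1,
      cFace ((y + cornerUnit 1, (2 : Fin 4)).1, (y + cornerUnit 1, (2 : Fin 4)).2 + 1)) ∧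
    cornersAt y 1 3 = (((cornerPartner (y + cornerUnit 1, (2 : Fin 4))).1,
        (cornerPartner (y + cornerUnit 1, (2 : Fin 4))).2 + 1).1,
      cFace ((cornerPartner (y + cornerUnit 1, (2 : Fin 4))).1,
        (cornerPartner (y + cornerUnit 1, (2 : Fin 4))).2 + 1)) := by
  refine ⟨Prod.ext ?_ ?_, Prod.ext ?_ ?_, Prod.ext ?_ ?_, Prod.ext ?_ ?_⟩ <;>
    refine Site.ext_two ?_ ?_ <;>
    simp [cornersAt, ex, cFace, faceAt, cornerOff, cornerPartner, cornerUnit, show (2 : Fin 4) + 1 = 3 from rfl,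
      show (2 : Fin 4) + 2 = 0 from rfl, show (0 : Fin 4) + 1 = 1 from rfl]

/-- The medial vertex `mv (y, i)` is the target edge of the in-dart `P`. [folklore] -/
theorem mv_eq_cTgt (y : Site 2) :
    mv (y, 0) = cTgt (y + cornerUnit 0, (1 : Fin 4)) ∧ mv (y, 1) = cTgt (y + cornerUnit 1, (2 : Fin 4)) := by
  constructor
  · have h2 : cornerUnit ((1 : Fin 4) + 1) = -cornerUnit 0 := cornerUnit_add_two 0
    rw [mv, cTgt]
    dsimp only
    rw [h2, ← sub_eq_add_neg, add_sub_cancel_right, Sym2.eq_swap]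
    rfl
  · have h2 : cornerUnit ((2 : Fin 4) + 1) = -cornerUnit 1 := cornerUnit_add_two 1
    rw [mv, cTgt]
    dsimp only
    rw [h2, ← sub_eq_add_neg, add_sub_cancel_right, Sym2.eq_swap]
    rfl

/-! ### Geometry: the `2δ`-ball around the midpoint of a deep edge -/

/-- A point of the closed face `faceAt v j` is within sup-distance `1` of `v`. [folklore] -/
theorem abs_sub_le_of_mem_closedSq_faceAt {v : Site 2} {j : Fin 4} {z : ℂ} (hz : z ∈ closedSq (faceAt v j)) :
    |z.re - v 0| ≤ 1 ∧ |z.im - v 1| ≤ 1 := by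
  have h0 := hz 0
  have h1 := hz 1
  simp only [Percolation.coordVec_zero, Percolation.coordVec_one] at h0 h1
  obtain ⟨⟨e00, e01⟩, ⟨e10, e11⟩, ⟨e20, e21⟩, ⟨e30, e31⟩⟩ := faceAt_apply v
  have hk : j = 0 ∨ j = 1 ∨ j = 2 ∨ j = 3 := by fin_cases j <;> simp
  rcases hk with rfl | rfl | rfl | rfl
  · rw [e00, e01] at *; rw [abs_le, abs_le]; exact ⟨⟨by linarith, by linarith⟩, by linarith, by linarith⟩
  · rw [e10, e11] at *; push_cast at h0; rw [abs_le, abs_le]; exact ⟨⟨by linarith, by linarith⟩, by linarith, by linarith⟩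
  · rw [e20, e21] at *; push_cast at h0 h1; rw [abs_le, abs_le]
    exact ⟨⟨by linarith, by linarith⟩, by linarith, by linarith⟩
  · rw [e30, e31] at *; push_cast at h1; rw [abs_le, abs_le]; exact ⟨⟨by linarith, by linarith⟩, by linarith, by linarith⟩

/-- **The faces at the endpoints of an edge lie in the `2δ`-ball around its midpoint**: for the
edge `e = cTgt (v, k)` (endpoints `v`, `v + u_{k+1}`) every closed face at either endpoint lies
within distance `2δ` of `medialPoint δ e` (the farthest corners are at distance `δ√13/2 < 2δ`).
[folklore] -/
theorem smul_closedSq_subset_closedBall {δ : ℝ} (hδ : 0 ≤ δ) (v : Site 2) (k j : Fin 4) :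
    δ • closedSq (faceAt v j) ⊆ closedBall (medialPoint δ (cTgt (v, k))) (2 * δ) ∧
    δ • closedSq (faceAt (v + cornerUnit (k + 1)) j) ⊆ closedBall (medialPoint δ (cTgt (v, k))) (2 * δ) := by
  have key : ∀ (w : Site 2) (z : ℂ), z ∈ closedSq (faceAt w j) →
      ‖z - (Site.toComplex w + (Site.toComplex v + I ^ (k : ℕ) * I / 2 - Site.toComplex w))‖ =
        ‖z - (Site.toComplex v + I ^ (k : ℕ) * I / 2)‖ := by
    intro w z _; congr 1; ring
  have bound : ∀ (a b s t : ℝ), |a| ≤ 1 → |b| ≤ 1 → ((s = 1/2 ∨ s = -1/2) ∧ t = 0 ∨ s = 0 ∧ (t = 1/2 ∨ t = -1/2)) →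
      ‖((a : ℂ) + (b : ℂ) * I) - ((s : ℂ) + (t : ℂ) * I)‖ ≤ 2 := by
    intro a b s t ha hb hst
    rw [abs_le] at ha hb
    have hsq : ‖((a : ℂ) + (b : ℂ) * I) - ((s : ℂ) + (t : ℂ) * I)‖ ^ 2 ≤ 4 := by
      rw [Complex.sq_norm, Complex.normSq_apply]
      simp only [sub_re, sub_im, add_re, add_im, mul_re, mul_im, ofReal_re, ofReal_im, I_re, I_im,
        mul_zero, mul_one, sub_zero, zero_add, add_zero]
      rcases hst with ⟨hs | hs, ht⟩ | ⟨hs, ht | ht⟩ <;> rw [hs, ht] <;> nlinarith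
    nlinarith [norm_nonneg (((a : ℂ) + (b : ℂ) * I) - ((s : ℂ) + (t : ℂ) * I))]
  have hmid : medialPoint δ (cTgt (v, k)) = δ • (Site.toComplex v + I ^ (k : ℕ) * I / 2) := by
    rw [medialPoint_cTgt, meshPoint, Complex.real_smul]; ring
  have hI : ∀ m : Fin 4, ∃ s t : ℝ, I ^ (m : ℕ) * I / 2 = (s : ℂ) + (t : ℂ) * I ∧
      ((s = 1/2 ∨ s = -1/2) ∧ t = 0 ∨ s = 0 ∧ (t = 1/2 ∨ t = -1/2)) := by
    intro m
    fin_cases m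
    · exact ⟨0, 1/2, by push_cast; ring, Or.inr ⟨rfl, Or.inl rfl⟩⟩
    · exact ⟨-1/2, 0, by push_cast; rw [pow_one, I_mul_I]; ring, Or.inl ⟨Or.inr rfl, rfl⟩⟩
    · exact ⟨0, -1/2, by push_cast; rw [pow_two, I_mul_I]; ring, Or.inr ⟨rfl, Or.inr rfl⟩⟩
    · exact ⟨1/2, 0, by push_cast; rw [pow_succ, pow_two, I_mul_I]; ring_nf; rw [I_sq]; ring, Or.inl ⟨Or.inl rfl, rfl⟩⟩
  obtain ⟨s, t, hst, hcase⟩ := hI k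
  have hunit : Site.toComplex (cornerUnit (k + 1)) = 2 * ((s : ℂ) + (t : ℂ) * I) := by
    rw [toComplex_cornerUnit_succ, ← hst]; ring
  have hz : ∀ z : ℂ, ∃ a b : ℝ, z = (a : ℂ) + (b : ℂ) * I ∧ z.re = a ∧ z.im = b :=
    fun z => ⟨z.re, z.im, (Complex.re_add_im z).symm, rfl, rfl⟩
  constructor
  · rintro _ ⟨z, hzq, rfl⟩
    obtain ⟨ha, hb⟩ := abs_sub_le_of_mem_closedSq_faceAt hzq
    obtain ⟨a, b, hab, hre, him⟩ := hz (z - Site.toComplex v)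
    rw [mem_closedBall, hmid, dist_eq_norm, ← smul_sub, norm_smul, Real.norm_of_nonneg hδ, mul_comm]
    refine mul_le_mul_of_nonneg_right ?_ hδ
    rw [show z - (Site.toComplex v + I ^ (k : ℕ) * I / 2) = (z - Site.toComplex v) - I ^ (k : ℕ) * I / 2 by ring,
      hab, hst]
    refine bound a b s t ?_ ?_ hcase
    · rw [← hre]; simpa [Site.toComplex] using ha
    · rw [← him]; simpa [Site.toComplex] using hb
  · rintro _ ⟨z, hzq, rfl⟩
    obtain ⟨ha, hb⟩ := abs_sub_le_of_mem_closedSq_faceAt hzq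
    obtain ⟨a, b, hab, hre, him⟩ := hz (z - Site.toComplex (v + cornerUnit (k + 1)))
    rw [mem_closedBall, hmid, dist_eq_norm, ← smul_sub, norm_smul, Real.norm_of_nonneg hδ, mul_comm]
    refine mul_le_mul_of_nonneg_right ?_ hδ
    have hvadd : Site.toComplex (v + cornerUnit (k + 1)) = Site.toComplex v + Site.toComplex (cornerUnit (k + 1)) := by
      apply Complex.ext <;> simp [Site.toComplex]
    rw [show z - (Site.toComplex v + I ^ (k : ℕ) * I / 2) =
      (z - Site.toComplex (v + cornerUnit (k + 1))) - (I ^ (k : ℕ) * I / 2 - Site.toComplex (cornerUnit (k + 1))) by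
        rw [hvadd]; ring, hab, hst, hunit, show ((s : ℂ) + (t : ℂ) * I) - 2 * ((s : ℂ) + (t : ℂ) * I) =
          ((-s : ℝ) : ℂ) + ((-t : ℝ) : ℂ) * I by push_cast; ring]
    refine bound a b (-s) (-t) ?_ ?_ ?_
    · rw [← hre]; simpa [Site.toComplex] using ha
    · rw [← him]; simpa [Site.toComplex] using hb
    · rcases hcase with ⟨hs | hs, ht⟩ | ⟨hs, ht | ht⟩ <;> rw [hs, ht] <;> norm_num

/-- A face whose closed square lies in the domain and one of whose corners lies in `Ω_δ` is an
inner face. [cite: Smirnov2001, §2] -/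
theorem isInnerFace_of_smul_closedSq_subset {f w : Site 2} (hw : IsCorner w f) (hwD : w ∈ meshDomain E.Ω E.δ)
    (hsub : E.δ • closedSq f ⊆ E.Ω) : E.IsInnerFace f := by
  by_contra h
  obtain ⟨y, hy, hyΩ⟩ := exists_mem_closedSq_not_mem h hw hwD
  exact hyΩ (hsub hy)

/-- **A `2δ`-deep edge has all faces at both endpoints inner** (if its vertex lies in `Ω_δ`).
[cite: Smirnov2001, §2] -/
theorem faces_inner_of_ball (hδ : 0 < E.δ) {v : Site 2} {k : Fin 4} (hvD : v ∈ meshDomain E.Ω E.δ)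
    (hball : closedBall (medialPoint E.δ (cTgt (v, k))) (2 * E.δ) ⊆ E.Ω) :
    (∀ j, E.IsInnerFace (faceAt v j)) ∧ (∀ j, E.IsInnerFace (faceAt (v + cornerUnit (k + 1)) j)) := by
  have h1 : ∀ j, E.IsInnerFace (faceAt v j) := fun j =>
    isInnerFace_of_smul_closedSq_subset (isCorner_faceAt v j) hvD
      ((smul_closedSq_subset_closedBall hδ.le v k j).1.trans hball)
  refine ⟨h1, fun j => ?_⟩
  have hv'D : v + cornerUnit (k + 1) ∈ meshDomain E.Ω E.δ :=
    mem_meshDomain_of_isCorner_of_isInnerFace ((isCorner_faceAt_four v k).2.2.1) (h1 k)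
  exact isInnerFace_of_smul_closedSq_subset (isCorner_faceAt _ j) hv'D
    ((smul_closedSq_subset_closedBall hδ.le v k j).2.trans hball)

/-- A site all of whose four faces are inner is not a boundary site of the face domain (hence on
neither discrete arc). [cite: Smirnov2001, §2] -/
theorem not_mem_zdBoundary_of_faces_inner {x : Site 2} (hx : ∀ j, E.IsInnerFace (faceAt x j)) :
    x ∉ E.zdBoundary := by
  rintro (⟨-, y, hxy, hn⟩ | ⟨y, -, -, f, hf, hxf, -⟩)
  · obtain ⟨k, rfl⟩ := exists_eq_add_cornerUnit hxy
    exact hn (DiscreteDobrushin.adj_of_isInnerFace_faceAt (hx k) (Or.inl rfl))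
  · obtain ⟨k, rfl⟩ := exists_faceAt_of_isCorner hxf
    exact hf (hx k)

/-- **The toggling hypotheses for the one-edge involution at an interior edge.** For
`e = cTgt p` with all faces at both endpoints inner, the completions of `ω` and `ω ∆ {e}` agree
off `e` and differ at `e`, and no endpoint of `e` lies on the arc `B`. [cite: Smirnov2010, proof of Lemma 4.5] -/
theorem toggle_hypotheses_symmDiff {p : Site 2 × Fin 4}
    (hx : ∀ j, E.IsInnerFace (faceAt p.1 j)) (hy : ∀ j, E.IsInnerFace (faceAt (p.1 + cornerUnit (p.2 + 1)) j))
    (ω : BondConfig (Site 2)) :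
    (∀ f, f ≠ cTgt p → (f ∈ E.bcBondConfig (symmDiff ω {cTgt p}) ↔ f ∈ E.bcBondConfig ω)) ∧
    ¬ (cTgt p ∈ E.bcBondConfig (symmDiff ω {cTgt p}) ↔ cTgt p ∈ E.bcBondConfig ω) ∧
    (∀ x ∈ cTgt p, x ∉ E.zdArcB) := by
  have hends : ∀ x ∈ cTgt p, x ∉ E.zdBoundary := by
    intro x hxe
    rw [cTgt] at hxe
    rcases Sym2.mem_iff.1 hxe with rfl | rfl
    · exact not_mem_zdBoundary_of_faces_inner hx
    · exact not_mem_zdBoundary_of_faces_inner hy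
  have hBe : ∀ x ∈ cTgt p, x ∉ E.zdArcB := fun x hxe h => hends x hxe (E.zdArcB_subset_zdBoundary h)
  have hAe : ¬ ∀ x ∈ cTgt p, x ∈ E.zdArcA := fun h =>
    hends p.1 (by rw [cTgt]; exact Sym2.mem_mk_left _ _) (E.zdArcA_subset_zdBoundary (h p.1 (by rw [cTgt]; exact Sym2.mem_mk_left _ _)))
  have hedge : cTgt p ∈ (discreteDomainGraph E.Ω E.δ).edgeSet := by
    rw [cTgt, SimpleGraph.mem_edgeSet]
    exact DiscreteDobrushin.adj_of_isInnerFace_faceAt (hx (p.2 + 1)) (Or.inl rfl)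
  refine ⟨fun f hf => ?_, fun h => ?_, hBe⟩
  · simp only [DiscreteDobrushin.mem_bcBondConfig_iff, Set.mem_symmDiff, Set.mem_singleton_iff, hf, not_false_iff,
      and_true, false_and, or_false]
  · simp only [DiscreteDobrushin.mem_bcBondConfig_iff, Set.mem_symmDiff, Set.mem_singleton_iff, hedge, true_and,
      not_true, and_false] at h
    tauto

/-! ### The exploration never carries a corner with non-inner face -/

/-- A dart of the exploration path lies in an inner face: the dart phase sum at a corner whose
face is not inner vanishes, for every datum and every configuration. [cite: Smirnov2001, §2] -/
theorem dartPhaseSum_eq_zero_of_not_isInnerFace :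
    ∀ (E : DiscreteDobrushin) (ω : BondConfig (Site 2)) (δ σ : ℝ) (r : Site 2 × Fin 4),
      ¬ E.IsInnerFace (cFace r) → Parafermion.dartPhaseSum (medialExploration E ω) δ σ (r.1, cFace r) = 0 := by
  intro E ω δ σ r hr
  rcases medialExploration_eq_nil_or E ω with h | h
  · rw [h]; exact Parafermion.dartPhaseSum_nil _ _ _
  · refine Finset.sum_eq_zero fun k hk => ?_
    exfalso
    rw [Finset.mem_filter, Finset.mem_range] at hk
    obtain ⟨hk, h1, h2⟩ := hk
    obtain ⟨hk1, h2'⟩ := List.getElem?_eq_some_iff.1 h2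
    obtain ⟨_, h1'⟩ := List.getElem?_eq_some_iff.1 h1
    obtain ⟨v, f, hvf, hin, hs, ht⟩ := h.step _ _ (infix_pair_getElem' _ k hk1)
    rw [h1', cornerSource_cFace] at hs
    rw [h2', cornerTarget_cFace] at ht
    obtain ⟨j, rfl⟩ := exists_faceAt_of_isCorner hvf
    rw [cornerSource_faceAt] at hs
    rw [cornerTarget_faceAt] at ht
    have e := eq_of_cSrc_eq_of_cTgt_eq (p := (v, j)) (q := r) hs ht
    apply hr
    rw [← e]
    exact hin

end Assembly


end Summit.CriticalPhenomena.CardyFormulaZ2.Cruxes.ParafermionPrecompact.KenyonStreamSecondRelation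

end
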